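import Literature.MathematicalPhysics.QuantumFieldTheory.Balaban1983to89.B2Eq342TowerRun
import Literature.MathematicalPhysics.QuantumFieldTheory.Balaban1983to89.B2Eq341Zeta

/-!
# `Balaban1983to89.B2Eq346TowerZeta` — T. Bałaban, *(Higgs)₂,₃ quantum fields in a finite volume. II. An upper bound*,
Commun. Math. Phys. **86** (1982) 555–594 [Balaban1982Higgs2], Sect. 3.C pp. 592–594: **(3.43)–(3.46) ON THE TORUS for the
constructed tower — the cubes `𝒞_k` with the seam cube MERGED (so that the printed count `3^d` of (3.44)/(3.45) holds on
`T₁^{(k)}`), r02's/r14's dictionary of (2.7)/(2.9)/(3.41) (`B2Eq29Resummation`, `B2Eq341Zeta`) INSTANTIATED at every level,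
(3.46) for ζ″ := (3.41) PROVED, the covering (3.50)/(3.52) re-derived for the merged cubes — hence (3.42) `B2.Ineq342With`
and the claim of Sect. 3.C `B2.Claim342Printed` for the family of all constructed towers with ζ″ := (3.41) DEFINED, with NO
field-side hypothesis left (only the printed constants' ranges)**

statement-level skeleton of published theorems with citation tags; proofs where landed; nothing here is a claim about the Yang–Mills mass gap

PDF held: `paper:balaban1982-cmp86-higgs23-ii` (journal page = PDF page + 554); pp. 558, 566, 570, 592–594 through the verbatim
transcriptions in r02's `B2Eq29Resummation`, r14's `B2`/`B2Sect3C`/`B2Eq341Zeta`, p23's `B2Ineq342From346` and the typer's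
`B2Eq345TowerCubes`/`B2Eq342TowerRun` (renders `run/shared/lean/pub/pub-balaban/b2b-balaban-ref1/pages/1982-cmp86-higgs23-II/`).

CITATION HEADER (lean-in-tree rule).  lit-balaban typed skeleton (HOME `run/shared/lean/pub/lit-balaban/`), typer line
(concrete carriers), gen 10, sequel of `B2Eq342TowerRun` (its HONEST SCOPE (d): *"wiring [r14's `zeta341_le`] to `coverIn`
needs the torus form of the 3^d count (3.44)/(3.45), not done here"*).  SKELETON rows served: **B2.Eq3.47** (members
(3.43)–(3.46): the count (3.44)/(3.45) PROVED on the torus for merged cubes, `card_near_le`/`mcube_mem_near`; (3.46) PROVED for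
the constructed tower, `zeta341_tower_le`; (3.50)/(3.52) for the merged cubes, `card_compl_towerRegion_le_352_coverM(_rFn)`,
`bound352M`), **B2.Eq3.42** (`ineq342_concrete`, `claim342_concrete`: the decl of record `B2.Claim342Printed` for the family
`famC` with ζ″ := (3.41)), B2.Eq2.9 (the step's data is an admissible tuple, `admissible_data`).  Owners: r02 (B2 fold, author of
`B2Eq29Resummation`), r14 (second reader, author of `B2Eq341Zeta`, `B2Sect3C`), p23 (`B2Ineq342From346`); referee ref-4.
NOTHING of record is restated: (3.41) IS r14's `zeta341` (applied to this file's dictionary), (3.46) IS r14's `zeta341_le`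
with its hypotheses `hnear`/`hcard` DISCHARGED here, the covering IS gen 9's `towerRegion_anti_seed` +
`B2Eq352TowerVolumeBound.card_compl_towerRegion_le_352` applied to this file's representatives, (3.42)/(3.53)–(3.54) ARE p23's
`ineq342_of_346_blocks` / r14's `exponent_nonpos` inside it, the threshold bookkeeping is r14's `B2.coeff354_threshold` /
`B2.logScale_ge`.

THE SOURCE TEXT (p. 592 [PDF 38] – p. 593 [PDF 39], verbatim in `B2Eq341Zeta`'s header).  *"Let us consider a regular partition
of T₁ into a lattice of cubes, each cube is a sum of large blocks and a length of its side is bigger r(ε), and less 2r(ε). …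
Now if to every element of the set P_v^{(0)} ∪ … ∪ R_s^{(0)} we assign a cube □ having a common point with this element and
3^d − 1 cubes neighbouring with □, then the sum of all these cubes contains the set ∪𝒞₀. It is so because a distance of each
large block contained in Λ₀^{(0)c} from the set P_v^{(0)} ∪ … ∪ R_s^{(0)} is ≤ r(ε). Thus we have |𝒞₀| ≤ 3^d(|P_v^{(0)}| + … +
|R_s^{(0)}|). (3.44) … (3.45) … ζ″_{Λ₀^{(k)}}(…) ≤ Σ_{all the subsets of Λ₀^{(k)c}} exp(−c₀p(Lᵏε)²|𝒞_k|)(…) = 2^{6|Λ₀^{(k)c}|}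
exp(−c₀p(Lᵏε)²|𝒞_k|)(…). (3.46)"*

DICTIONARY (print ↦ Lean), at level `k` of the run with data `s`.  the regular partition into cubes of side in `]r, 2r[`
consisting of large blocks ↦ `mcube q` (`q = qOf P r k` large blocks per side, gen 9; side `w = qLM` sites, `cubeW`; per
direction the label `mlab N w v = min(v / w, N / w − 1)`, the incomplete seam cube MERGED into the last full one — see
HONEST SCOPE (a)); *"a cube □ having a common point with this element and 3^d − 1 cubes neighbouring with □"* ↦ `near q z`
(`|near| ≤ 3^d`, `card_near_le`); the elements of the six sets with their sorts ↦ `S = Site P k × Fin 6`, sort = `Prod.snd`;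
the large blocks ↦ their sites (`β = Site P k`, everything below is a union of large blocks); *"large blocks … contained in
Λ₇^{(k−1)′}, distant from [the element] less than r(Lᵏε)"* ↦ `nbr WF ρ z` / `N6`; `Λ₇^{(k−1)′} ∩ Λ₀^{(k)c}` on large blocks ↦
`WA Q s k` = gen 9's `inA`; 𝒞_k ↦ `coverM` (= `W.image (mcube q)`); ζ″_{Λ₀^{(k)}} ↦ `zetaT Q s k` = r14's `zeta341` over this
dictionary at `p(Lᵏε)`; the run with ζ″ := (3.41) ↦ `towerRun P Q (concreteF P Q C₇ C₅)`, its data ↦ `towerCDataM` (`|𝒞_l|` =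
`|coverM_l|`); the family of (2.117) ↦ `famC Q M C₇ C₅ : ℝ → InstanceC Q M → B2.Run`.

WHAT THIS FILE PROVES (0 sorry; standard axioms; definitions with bodies + theorems; no `Prop`-valued definition).
§1 one direction: `mlab`, `mnum`; `mlab_add_of_lt` (a step `< w` raises the label by ≤ 1), `mlab_eq_zero_of_lt`,
   `mlab_eq_last`, `sub_le_of_mlab_eq` (equal labels ⇒ `≤ 2w − 1` apart), **`mlab_mem_nearLab`** (cyclic distance `≤ w − 1` ⇒
   the label is among the 3 labels `c, c ± 1 (mod m)`).
§2 the torus: `mcube`, `mcube_congr` (a function of the large block), `tdist_le_of_mcube_eq(_real)` (diameter `≤ 2w − 1`),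
   `near`, **`card_near_le : |near| ≤ 3^d`**, **`mcube_mem_near`** (THE COUNT (3.44)/(3.45) on the torus).
§3 the dictionary: `nbr`, `N6`, `WA`, `mem_WA` (= the printed premise of (3.45)), **`admissible_data`** (the step's data, with any
   sorts, is an admissible tuple for `W` — r02's `Admissible`), **`outer_subset`/`card_outer_le`** (r02's outer elements lie in
   `Λ₀^{(k)c} × 6 sorts`), `coverM`, `mcube_mem_near_of_mem_nbr` (r14's `hnear`), **`zeta341_tower_le`** ((3.46) FOR THE TOWER:
   `ζ″ ≤ e^{(6 log 2)|Λ₀^{(k)c}|}·e^{−c₀p²|𝒞_k|}` with the printed `c₀ = B2.c0 a γ₀ d`), `zeta341_tower_nonneg`.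
§4 the covering for merged cubes: `mcubeRep(s)`, `exists_mcubeRep_near`, `srcM`, `rM = 2(r + LM)`, `relSeed_subset_relSeed_srcM`,
   `towerRegionF_srcM_subset`, **`card_compl_towerRegion_le_352_coverM(_rFn)`** ((3.52) charged to `Σ_l |coverM_l|`).
§5 the chain: `towerCDataM`, `DM352`, `bound352M` (r14's leaf `Bound352` for the run, merged cubes), `collar7M`/`collar5M`, `zetaT`,
   `concreteF`, **`ineq342_concrete : … → B2.Ineq342With Q (towerRun P Q (concreteF P Q C₇ C₅)) (C₇ + C₅ + 1)`** (hypotheses: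
   constants' ranges, `Lᴷε ≤ 1`, per-scale (3.54)), `InstanceC`/`famC`/`DuM`, **`claim342_concrete : Q.Printed → 1 ≤ Q.R →
   2 ≤ Q.r → 0 ≤ Q.κ₀ → (d+1)r < 2p → 0 ≤ C₇ → 0 ≤ C₅ → B2.Claim342Printed Q (famC Q M C₇ C₅)`**.
§7 (v1.2, append-only): `mkInstanceC`, **`instanceC_nonempty`** (the family of `claim342_concrete` is inhabited for the printed ranges: tori of every `K`, `ε`).
v1.3 (docstring only; no declaration, statement or proof changed): the docstring of `zeta341_tower_le` now lists exactly the
   hypotheses of its signature (`hk`, `hρ`, `ha`, `hγ`, any `pk`) — referee ref-1 g33 F4-minor erratum (REFEREE.md Gen 33).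
§6 (v1.1, append-only; no v1 declaration changed): **`card_coverM_le_three_pow`** ((3.45) AS PRINTED on the torus for the step's data:
   `|𝒞_k| ≤ 3^d·|P^{(k)}|`, r14's `card_cover_le` instantiated) and **`zetaT_pos`** (ζ″ := (3.41) is a non-empty sum: `> 0`).
HONEST SCOPE.  (a) CUBES: the print's partition into cubes of side in `]r(Lᵏε), 2r(Lᵏε)[` consisting of large blocks need not
exist on `T₁^{(k)}` (the number `2L^{K−k−1}L′_μ` of large blocks per direction need not be divisible by a `q` with `qLM ∈ ]r,
2r[`); this file's cubes have `q = ⌊r/(LM)⌋ + 1` large blocks per side (`qLM ∈ ]r, r + LM]`) except the LAST cube of each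
direction, which absorbs the remainder (side `< 2qLM ≤ 2r + 2LM`); with gen 9's TRUNCATED seam cube (`B2Eq345TowerCubes.cubeOf`)
the count (3.44) can reach `4` cubes per direction (e.g. `q = 10` blocks, `32` blocks in a direction: cubes `[0,10), [10,20),
[20,30), [30,32)`; a point in block `28` is within `9` blocks of the four cubes `1, 2, 3, 0`), which is why the cubes are
merged here; all sides are `≥ qLM > r(Lᵏε)` (when the direction has `≥ q` large blocks; otherwise the direction is one cube) and
the count is the printed `3^d`.  Consequently the O(1) of (3.52) is `((4·max(i+1,8)·S351·LM + 1)·2(1 + LM))^d` (twice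
`B2Eq342TowerRun.D352`'s base).  (b) ELEMENTS: the six sorts are read uniformly as sites of `T₁^{(k)}` with the large-block
distance of (2.7) (gen 8's `lbDist`; print: `B(P_v)`, `B(P_s)` blocks of points, `Q`, `R` points/bonds) — the dictionary's
`N` does not depend on the sort; the weights do (r14's `coef341`: `⅛a, ¼γ₀, ¼γ₀, ⅛a, ¼γ₀, 1`).  (c) `a₆ = 6 log 2` is the
print's `2^{6|Λ₀^{(k)c}|}` (r14 counts `2^{#outer}`, `#outer ≤ 6|Λ₀^{(k)c}|` here); the sequence count is p23's with `m = 1`,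
`θ = d + 1` as in `B2Eq342TowerRun`.  (d) CONSTANTS: `R ≥ 1`, `r ≥ 2`, strict `2p > (d+1)r`, `Lᴷε ≤ 1` as in `B2Sect3C` /
`B2Ineq342From346` / `B2Eq342TowerRun` (cell GAPS G-pv04-2).  (e) NOT touched: WHERE ζ″ comes from — the bound of the k-th
step's characteristic functions by the small factors ((3.31)–(3.40), rows B2.Eq3.32–3.40) is the field-theoretic content
upstream of (3.41) and stays with its owners; here ζ″ := (3.41) is the printed combinatorial quantity.  Value = Sect. 3.C
closed in the kernel for the regions and cubes the series constructs on the (Higgs)₂,₃ tori; NOT summit progress.  Unit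
`lit-balaban-typer` gen 10 (literature-prover-lit-balaban-typer-g10-0); HOME/FILED.md records the proposal.
-/

noncomputable section

open scoped BigOperators

namespace Literature.MathematicalPhysics.QuantumFieldTheory.Balaban1983to89.B2Eq346TowerZeta

open HiggsRescaling (largeBlockOf largeBlock)
open B2Eq28RegionsConcrete (lbDist lbDist_le_tdist mem_largeBlock mem_largeBlock_self largeBlockOf_val)
open B2Eq255RegionsWindow (inLB mem_inLB relSeed mem_relSeed regionRel mem_regionRel_zero not_mem_regionRel
  regionRel_subset_inLB)
open B2Eq243RegionsTower (towerRegion towerRegion_eq window)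
open B2Eq324NestedRegions (prime)
open B2Eq350TowerVolume (towerRegionF)
open B2Eq352TowerVolumeBound (coef352 one_le_rFn rFn_nonneg rFn_rescale_le card_compl_towerRegion_le_352)
open B2Eq345TowerCubes (windowF inA mem_inA coverIn qOf qOf_pos LM_pos lt_side side_le rIn le_rIn one_le_rIn rIn_rescale
  towerRegion_anti_seed coef352_nonneg)
open B2Eq342TowerRun (LFData dataOf dataOf_of_lt radius lam lam_of_lt lamPrev towerRun FieldData D352 mesh_le_one_of_le
  radius_pos)
open B2Sect3C (CData Bound352 S351 one_le_S351)
open B1Ineq234Concrete (tdist_self)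

variable {P : HiggsLattice.Params}

/-! ## §1 Merged cubes in one direction: labels `min(v / w, N / w − 1)` of the coordinates `v ∈ [0, N)` for cubes of `w`
sites per side, the last cube absorbing the remainder (every cube has `≥ w` sites whenever `N ≥ w`) -/

section OneDirection

/-- **Merged cube label in one direction**: the coordinate `v` of a lattice direction with `N` sites, for cubes of side `w`
sites, lies in the cube `min(v / w, N / w − 1)` — the regular partition into cubes of side `w` (*"a regular partition of
T₁ into a lattice of cubes"*, p. 592) with the incomplete cube at the seam MERGED into its neighbour, so that every cube
has side `≥ w` (the print's exact tiling need not exist on the torus: `w` need not divide `N`). [cite: Balaban1982Higgs2, (3.43) p.592] -/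
def mlab (N w v : ℕ) : ℕ := min (v / w) (N / w - 1)

/-- The number of merged cubes in a direction: `max(N / w, 1)`. [cite: Balaban1982Higgs2, (3.43) p.592] -/
def mnum (N w : ℕ) : ℕ := max (N / w) 1

/-- There is at least one cube. [cite: Balaban1982Higgs2, (3.43) p.592] -/
theorem mnum_pos (N w : ℕ) : 0 < mnum N w := lt_of_lt_of_le zero_lt_one (le_max_right _ _)

/-- The label of the last cube is `N / w − 1` (truncated). [cite: Balaban1982Higgs2, (3.43) p.592] -/
theorem mnum_sub_one (N w : ℕ) : mnum N w - 1 = N / w - 1 := by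
  unfold mnum
  rcases Nat.eq_zero_or_pos (N / w) with h | h
  · rw [h]; rfl
  · rw [max_eq_left h]

/-- Labels are `< mnum`. [cite: Balaban1982Higgs2, (3.43) p.592] -/
theorem mlab_lt_mnum (N w v : ℕ) : mlab N w v < mnum N w := by
  unfold mlab
  have h := mnum_sub_one N w
  have hp := mnum_pos N w
  have : min (v / w) (N / w - 1) ≤ N / w - 1 := min_le_right _ _
  omega

/-- The label depends on the coordinate only through `v / w`. [cite: Balaban1982Higgs2, (3.43) p.592] -/
theorem mlab_eq_of_div_eq {N w a b : ℕ} (h : a / w = b / w) : mlab N w a = mlab N w b := by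
  unfold mlab
  rw [h]

/-- Coordinates `< w` lie in the cube `0`. [cite: Balaban1982Higgs2, (3.43) p.592] -/
theorem mlab_eq_zero_of_lt {N w a : ℕ} (ha : a < w) : mlab N w a = 0 := by
  unfold mlab
  rw [Nat.div_eq_of_lt ha, Nat.zero_min]

/-- Coordinates in the top `w − 1` lie in the last cube. [cite: Balaban1982Higgs2, (3.43) p.592] -/
theorem mlab_eq_last {N w v : ℕ} (hw : 0 < w) (hv : N - w + 1 ≤ v) : mlab N w v = mnum N w - 1 := by
  rw [mnum_sub_one]
  unfold mlab
  apply min_eq_right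
  rcases Nat.eq_zero_or_pos (N / w) with h0 | hpos
  · rw [h0]; exact Nat.zero_le _
  · rw [Nat.le_div_iff_mul_le hw]
    have h1 : N / w * w ≤ N := Nat.div_mul_le_self N w
    have h2 : (N / w - 1) * w = N / w * w - w := by
      rw [Nat.sub_mul, one_mul]
    rw [h2]
    have : 1 * w ≤ N / w * w := Nat.mul_le_mul_right w hpos
    omega

/-- **A step of length `< w` to the right raises the label by at most one** (every cube has `≥ w` sites).
[cite: Balaban1982Higgs2, (3.44) p.592] -/
theorem mlab_add_of_lt {N w v t : ℕ} (hw : 0 < w) (ht : t < w) :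
    mlab N w (v + t) = mlab N w v ∨ (mlab N w (v + t) = mlab N w v + 1 ∧ mlab N w v + 1 < mnum N w) := by
  have h1 : v / w ≤ (v + t) / w := Nat.div_le_div_right (Nat.le_add_right v t)
  have h2 : (v + t) / w ≤ v / w + 1 := by
    calc (v + t) / w ≤ (v + w) / w := Nat.div_le_div_right (by omega)
      _ = v / w + 1 := Nat.add_div_right v hw
  have hm := mnum_sub_one N w
  have hp := mnum_pos N w
  unfold mlab
  rcases Nat.eq_or_lt_of_le h1 with he | hlt
  · left; rw [← he]
  · have he : (v + t) / w = v / w + 1 := by omega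
    rw [he]
    by_cases hc : v / w + 1 ≤ N / w - 1
    · right
      rw [min_eq_left hc, min_eq_left (by omega)]
      exact ⟨rfl, by omega⟩
    · left
      rw [min_eq_right (by omega), min_eq_right (by omega)]

/-- **Two coordinates with the same merged label are at most `2w − 1` apart** (a merged cube has `< 2w` sites).
[cite: Balaban1982Higgs2, (3.43) p.592] -/
theorem sub_le_of_mlab_eq {N w a b : ℕ} (hw : 0 < w) (ha : a < N) (h : mlab N w a = mlab N w b) :
    a - b ≤ 2 * w - 1 := by
  set D := N / w with hD
  have hN : N < D * w + w := by rw [hD]; exact Nat.lt_div_mul_add hw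
  have haD : a / w * w ≤ a := Nat.div_mul_le_self a w
  have hbD : b / w * w ≤ b := Nat.div_mul_le_self b w
  have ha' : a < a / w * w + w := Nat.lt_div_mul_add hw
  have hb' : b < b / w * w + w := Nat.lt_div_mul_add hw
  unfold mlab at h
  by_cases hca : a / w ≤ D - 1
  · by_cases hcb : b / w ≤ D - 1
    · rw [min_eq_left hca, min_eq_left hcb] at h
      have : a / w * w = b / w * w := by rw [h]
      omega
    · rw [min_eq_left hca, min_eq_right (not_le.mp hcb).le] at h
      have hb1 : (D - 1) * w ≤ b / w * w := Nat.mul_le_mul_right w (not_le.mp hcb).le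
      have ha1 : a / w * w = (D - 1) * w := by rw [h]
      have hDw : (D - 1) * w = D * w - w := by rw [Nat.sub_mul, one_mul]
      omega
  · push Not at hca
    rw [min_eq_right hca.le] at h
    have hcb : D - 1 ≤ b / w := by
      by_contra hlt
      push Not at hlt
      rw [min_eq_left hlt.le] at h
      omega
    have ha1 : (D - 1) * w ≤ a / w * w := Nat.mul_le_mul_right w hca.le
    have hb1 : (D - 1) * w ≤ b / w * w := Nat.mul_le_mul_right w hcb
    have hDw : (D - 1) * w = D * w - w := by rw [Nat.sub_mul, one_mul]
    omega

/-- **The `3` labels around a label `c`**: `c`, `c + 1`, `c − 1` cyclically (`m` cubes).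
[cite: Balaban1982Higgs2, (3.44) p.592] -/
def nearLab (m c : ℕ) : Finset ℕ := {c, (c + 1) % m, (c + (m - 1)) % m}

/-- At most `3` labels. [cite: Balaban1982Higgs2, (3.44) p.592] -/
theorem card_nearLab_le (m c : ℕ) : (nearLab m c).card ≤ 3 := Finset.card_le_three

/-- **The one-dimensional count behind (3.44)/(3.45)**: on the cycle `ℤ/N` two coordinates at cyclic distance `≤ w − 1`
carry merged labels that coincide or are cyclically adjacent — the label of `a` is among the `3` labels around the label
of `b`. [cite: Balaban1982Higgs2, (3.44) p.592] -/
theorem mlab_mem_nearLab {N : ℕ} [NeZero N] {w : ℕ} (hw : 0 < w) (a b : ZMod N)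
    (h : min (a - b).val (b - a).val ≤ w - 1) :
    mlab N w a.val ∈ nearLab (mnum N w) (mlab N w b.val) := by
  have haN : a.val < N := ZMod.val_lt a
  have hbN : b.val < N := ZMod.val_lt b
  have hmp := mnum_pos N w
  simp only [nearLab, Finset.mem_insert, Finset.mem_singleton]
  by_cases hle : b.val ≤ a.val
  · have hab : (a - b).val = a.val - b.val := ZMod.val_sub hle
    rcases le_or_gt (a.val - b.val) (w - 1) with hsm | hbig
    · -- a = b + t, no wrap
      obtain ⟨t, ht⟩ : ∃ t, a.val = b.val + t := ⟨a.val - b.val, by omega⟩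
      have htw : t < w := by omega
      rcases mlab_add_of_lt (N := N) (v := b.val) hw htw with h1 | ⟨h1, h2⟩
      · exact Or.inl (by rw [ht, h1])
      · refine Or.inr (Or.inl ?_)
        rw [ht, h1, Nat.mod_eq_of_lt h2]
    · -- wrap: a in the top cube, b in the bottom cube
      have hne : a - b ≠ 0 := by
        intro h0
        rw [h0, ZMod.val_zero] at hab
        omega
      have hba : (b - a).val = N - (a.val - b.val) := by
        rw [← neg_sub, ZMod.neg_val, if_neg hne, hab]
      have h2 : (b - a).val ≤ w - 1 := by
        rcases min_le_iff.mp h with h1 | h1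
        · rw [hab] at h1; omega
        · exact h1
      rw [hba] at h2
      have hlast : mlab N w a.val = mnum N w - 1 := mlab_eq_last hw (by omega)
      have hzero : mlab N w b.val = 0 := mlab_eq_zero_of_lt (by omega)
      refine Or.inr (Or.inr ?_)
      rw [hlast, hzero, zero_add, Nat.mod_eq_of_lt (Nat.sub_lt hmp zero_lt_one)]
  · push Not at hle
    have hba : (b - a).val = b.val - a.val := ZMod.val_sub hle.le
    rcases le_or_gt (b.val - a.val) (w - 1) with hsm | hbig
    · obtain ⟨t, ht⟩ : ∃ t, b.val = a.val + t := ⟨b.val - a.val, by omega⟩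
      have htw : t < w := by omega
      rcases mlab_add_of_lt (N := N) (v := a.val) hw htw with h1 | ⟨h1, h2⟩
      · exact Or.inl (by rw [ht, h1])
      · refine Or.inr (Or.inr ?_)
        rw [ht, h1, add_assoc, Nat.add_sub_cancel' (Nat.one_le_of_lt hmp), Nat.add_mod_right,
          Nat.mod_eq_of_lt (mlab_lt_mnum N w a.val)]
    · have hne : b - a ≠ 0 := by
        intro h0
        rw [h0, ZMod.val_zero] at hba
        omega
      have hab : (a - b).val = N - (b.val - a.val) := by
        rw [← neg_sub, ZMod.neg_val, if_neg hne, hba]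
      have h2 : (a - b).val ≤ w - 1 := by
        rcases min_le_iff.mp h with h1 | h1
        · exact h1
        · rw [hba] at h1; omega
      rw [hab] at h2
      have hlast : mlab N w b.val = mnum N w - 1 := mlab_eq_last hw (by omega)
      have hzero : mlab N w a.val = 0 := mlab_eq_zero_of_lt (by omega)
      refine Or.inr (Or.inl ?_)
      rw [hlast, hzero, Nat.sub_add_cancel (Nat.one_le_of_lt hmp), Nat.mod_self]

end OneDirection

/-! ## §2 Merged cubes of `T₁^{(k)}`: cubes of `q^d` large blocks (`w = qLM` sites per side, the seam cube merged),
their diameter `< 2w`, and THE COUNT (3.44)/(3.45): the cubes met within distance `< w` of a site are among `3^d` cubes -/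

section Cubes

variable {k : ℕ}

/-- The side of the cubes in SITES: `w = q·LM` (`q` large blocks of side `LM`). [cite: Balaban1982Higgs2, (3.43) p.592] -/
def cubeW (P : HiggsLattice.Params) (q : ℕ) : ℕ := P.L * P.M * q

/-- `w > 0` for `q > 0`. [cite: Balaban1982Higgs2, (3.43) p.592] -/
theorem cubeW_pos {q : ℕ} (hq : 0 < q) : 0 < cubeW P q := Nat.mul_pos (Nat.mul_pos P.hL P.hM) hq

/-- **The merged cube of a site** of `T₁^{(k)}`: per direction the merged label of §1 of its coordinate, for `N = |T₁^{(k)}|_μ`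
sites and side `w = qLM`. [cite: Balaban1982Higgs2, (3.43) p.592] -/
def mcube (q : ℕ) (x : HiggsLattice.Site P k) : Fin P.d → ℕ :=
  fun μ => mlab (P.sitesPerDir k μ) (cubeW P q) (x μ).val

/-- *"each cube is a sum of large blocks"*: the merged cube depends only on the large block (the coordinate enters through
`x_μ / (qLM) = (x_μ / LM) / q`). [cite: Balaban1982Higgs2, (3.43) p.592] -/
theorem mcube_congr (q : ℕ) {x x' : HiggsLattice.Site P k} (h : largeBlockOf x = largeBlockOf x') :
    mcube q x = mcube q x' := by
  funext μ
  apply mlab_eq_of_div_eq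
  have hμ : ((largeBlockOf x) μ).val = ((largeBlockOf x') μ).val := by rw [h]
  rw [largeBlockOf_val, largeBlockOf_val] at hμ
  have e : ∀ v : ℕ, v / cubeW P q = v / (P.L * P.M) / q := fun v => (Nat.div_div_eq_div_mul v (P.L * P.M) q).symm
  rw [e, e, hμ]

/-- **A merged cube has diameter `≤ 2w − 1`** in the distance (1.3). [cite: Balaban1982Higgs2, (3.43) p.592] -/
theorem tdist_le_of_mcube_eq {q : ℕ} (hq : 0 < q) {x y : HiggsLattice.Site P k} (h : mcube q x = mcube q y) :
    HiggsLattice.Site.tdist x y ≤ 2 * cubeW P q - 1 := by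
  have hw := cubeW_pos (P := P) hq
  unfold HiggsLattice.Site.tdist
  refine Finset.sup_le fun μ _ => ?_
  have hμ : mlab (P.sitesPerDir k μ) (cubeW P q) (x μ).val = mlab (P.sitesPerDir k μ) (cubeW P q) (y μ).val :=
    congrFun h μ
  by_cases hle : (y μ).val ≤ (x μ).val
  · calc min (x μ - y μ).val (y μ - x μ).val ≤ (x μ - y μ).val := min_le_left _ _
      _ = (x μ).val - (y μ).val := ZMod.val_sub hle
      _ ≤ 2 * cubeW P q - 1 := sub_le_of_mlab_eq hw (ZMod.val_lt _) hμ
  · have hle' : (x μ).val ≤ (y μ).val := (not_le.mp hle).le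
    calc min (x μ - y μ).val (y μ - x μ).val ≤ (y μ - x μ).val := min_le_right _ _
      _ = (y μ).val - (x μ).val := ZMod.val_sub hle'
      _ ≤ 2 * cubeW P q - 1 := sub_le_of_mlab_eq hw (ZMod.val_lt _) hμ.symm

/-- The same in real form: `|x − y| ≤ 2w − 1 = 2qLM − 1`. [cite: Balaban1982Higgs2, (3.43) p.592] -/
theorem tdist_le_of_mcube_eq_real {q : ℕ} (hq : 0 < q) {x y : HiggsLattice.Site P k} (h : mcube q x = mcube q y) :
    (HiggsLattice.Site.tdist x y : ℝ) ≤ 2 * ((P.L : ℝ) * P.M * q) - 1 := by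
  have h1 := tdist_le_of_mcube_eq hq h
  have hw : 1 ≤ 2 * cubeW P q := by have := cubeW_pos (P := P) hq; omega
  have : ((2 * cubeW P q - 1 : ℕ) : ℝ) = 2 * ((P.L : ℝ) * P.M * q) - 1 := by
    rw [Nat.cast_sub hw]
    unfold cubeW
    push_cast
    ring
  rw [← this]
  exact_mod_cast h1

/-- **The `3^d` cubes around a site `z`**: products over the directions of the three labels around the label of `z` (*"a cube
□ having a common point with this element and 3^d − 1 cubes neighbouring with □"*). [cite: Balaban1982Higgs2, (3.44) p.592] -/
def near (q : ℕ) (z : HiggsLattice.Site P k) : Finset (Fin P.d → ℕ) :=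
  Fintype.piFinset fun μ => nearLab (mnum (P.sitesPerDir k μ) (cubeW P q)) (mcube q z μ)

/-- `|near| ≤ 3^d`. [cite: Balaban1982Higgs2, (3.44) p.592] -/
theorem card_near_le (q : ℕ) (z : HiggsLattice.Site P k) : (near q z).card ≤ 3 ^ P.d := by
  unfold near
  rw [Fintype.card_piFinset]
  calc ∏ μ, (nearLab (mnum (P.sitesPerDir k μ) (cubeW P q)) (mcube q z μ)).card
      ≤ ∏ _μ : Fin P.d, 3 := Finset.prod_le_prod' fun μ _ => card_nearLab_le _ _
    _ = 3 ^ P.d := by rw [Finset.prod_const, Finset.card_univ, Fintype.card_fin]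

/-- **THE COUNT (3.44)/(3.45) on the torus**: a site within distance `≤ w − 1` of `z` lies in one of the `3^d` cubes around
`z` (per direction §1's `mlab_mem_nearLab`). [cite: Balaban1982Higgs2, (3.44) p.592] -/
theorem mcube_mem_near {q : ℕ} (hq : 0 < q) {x z : HiggsLattice.Site P k}
    (h : HiggsLattice.Site.tdist x z ≤ cubeW P q - 1) : mcube q x ∈ near q z := by
  unfold near
  rw [Fintype.mem_piFinset]
  intro μ
  have hμ : min (x μ - z μ).val (z μ - x μ).val ≤ cubeW P q - 1 :=
    le_trans (Finset.le_sup (f := fun ν : Fin P.d => min (x ν - z ν).val (z ν - x ν).val) (Finset.mem_univ μ)) h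
  exact mlab_mem_nearLab (cubeW_pos hq) (x μ) (z μ) hμ

end Cubes

/-! ## §3 The dictionary of (2.7)/(2.9) (r02's `B2Eq29Resummation`) and (3.41) (r14's `B2Eq341Zeta`) AT LEVEL `k` OF THE
CONSTRUCTED TOWER: elements = sites with a sort, large blocks read as their sites, `N` = the sites of the window-interior
large blocks within `r(Lᵏε)` of the element, `W = Λ₇^{(k−1)′} ∩ Λ₀^{(k)c}` on large blocks (gen 9's `inA`); the data of the
step is an admissible tuple, the outer elements lie in `Λ₀^{(k)c}`, and (3.46) for ζ″ := (3.41) -/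

section Dictionary

open scoped Classical

variable {k : ℕ}

/-- **The large blocks within `ρ` of the element `z`, inside the window** (as their sites): `N z` of r02's dictionary for the
p. 570 family *"large blocks of the lattice T₁^{(k)} contained in Λ₇^{(k−1)′}, distant from [the element] less than
r(Lᵏε)"*. [cite: Balaban1982Higgs2, (2.7) p.558, (2.55) p.570] -/
def nbr (WF : Finset (HiggsLattice.Site P k)) (ρ : ℝ) (z : HiggsLattice.Site P k) : Finset (HiggsLattice.Site P k) :=
  Finset.univ.filter fun x => largeBlock (largeBlockOf x) ⊆ WF ∧ lbDist x z < ρ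

/-- Membership in `nbr`. [cite: Balaban1982Higgs2, (2.7) p.558] -/
theorem mem_nbr {WF : Finset (HiggsLattice.Site P k)} {ρ : ℝ} {z x : HiggsLattice.Site P k} :
    x ∈ nbr WF ρ z ↔ largeBlock (largeBlockOf x) ⊆ WF ∧ lbDist x z < ρ := by
  unfold nbr
  simp only [Finset.mem_filter, Finset.mem_univ, true_and]

/-- **The elements of the six sorts** `P_v, Q_v, R_v, P_s, Q_s, R_s` ((2.4)–(2.6)): a site with a sort label `σ : Fin 6`
(r14's `sort` = the second projection); their neighbourhoods do not depend on the sort.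
[cite: Balaban1982Higgs2, (2.6) p.557, (3.41) p.592] -/
def N6 (WF : Finset (HiggsLattice.Site P k)) (ρ : ℝ) : HiggsLattice.Site P k × Fin 6 → Finset (HiggsLattice.Site P k) :=
  fun e => nbr WF ρ e.1

/-- The window, the radius and the target `W` of the dictionary at level `k` of the run with data `s`: `WF = Λ₇^{(k−1)′}`
(gen 9's `windowF`), `ρ = r(Lᵏε)`, `W = Λ₇^{(k−1)′} ∩ Λ₀^{(k)c}` on the large blocks inside the window (gen 9's `inA`).
[cite: Balaban1982Higgs2, (3.45) p.592] -/
def WA (Q : B2.Params) (s : LFData P) (k : ℕ) : Finset (HiggsLattice.Site P k) := inA (dataOf s) (radius P Q) k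

/-- `W` unfolded: a site of `W` has its large block inside the window and lies within `r(Lᵏε)` of a large-field point of the
step (the printed premise of (3.45), gen 9's `exists_bad_near_of_mem_inA`), and conversely. [cite: Balaban1982Higgs2, (3.45) p.592] -/
theorem mem_WA {Q : B2.Params} {s : LFData P} {x : HiggsLattice.Site P k} :
    x ∈ WA Q s k ↔ largeBlock (largeBlockOf x) ⊆ windowF (dataOf s) (radius P Q) k ∧
      ∃ z ∈ dataOf s k, lbDist x z < radius P Q k := by
  unfold WA
  rw [mem_inA, towerRegionF, towerRegion_eq, mem_regionRel_zero]
  constructor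
  · rintro ⟨hW, hx⟩
    refine ⟨hW, ?_⟩
    by_contra hne
    push Not at hne
    exact hx ⟨hW, fun z hz => hne z (Finset.mem_coe.mp hz)⟩
  · rintro ⟨hW, z, hz, hlt⟩
    exact ⟨hW, fun h => absurd (h.2 z (Finset.mem_coe.mpr hz)) (not_le.mpr hlt)⟩

/-- **The step's own large-field data, with any sorts, is an ADMISSIBLE tuple for `W`** (p. 566: admissible = *"satisfying all
the conditions resulting from the construction"*; here: `⋃_{z ∈ data} N z = W`, r02's `Admissible`).
[cite: Balaban1982Higgs2, (2.9) p.558, (2.43) p.566] -/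
theorem admissible_data (Q : B2.Params) (s : LFData P) (k : ℕ) (σ : Fin 6) :
    B2Eq29Resummation.Admissible (N6 (windowF (dataOf s) (radius P Q) k) (radius P Q k)) (WA Q s k)
      ((dataOf s k) ×ˢ ({σ} : Finset (Fin 6))) := by
  unfold B2Eq29Resummation.Admissible
  ext x
  rw [B2Eq29Resummation.mem_nbhd, mem_WA]
  constructor
  · rintro ⟨e, he, hx⟩
    obtain ⟨hz, _⟩ := Finset.mem_product.mp he
    obtain ⟨hW, hlt⟩ := mem_nbr.mp hx
    exact ⟨hW, e.1, hz, hlt⟩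
  · rintro ⟨hW, z, hz, hlt⟩
    exact ⟨(z, σ), Finset.mem_product.mpr ⟨hz, Finset.mem_singleton_self σ⟩, mem_nbr.mpr ⟨hW, hlt⟩⟩

/-- **The outer elements lie in `Λ₀^{(k)c}`** (r02's `outer` = elements whose neighbourhood stays inside `W`; a site of `Λ₀^{(k)}`
has its own large block in its neighbourhood and not in `W`): for `k < K` and `r(Lᵏε) > 0`,
`outer ⊆ Λ₀^{(k)c} × (six sorts)`. [cite: Balaban1982Higgs2, (2.9) p.558, (3.46) p.593] -/
theorem outer_subset {Q : B2.Params} {s : LFData P} (hk : k < P.K) (hρ : 0 < radius P Q k) :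
    B2Eq29Resummation.outer (N6 (windowF (dataOf s) (radius P Q) k) (radius P Q k)) (WA Q s k)
      ⊆ (lam Q s k 0)ᶜ ×ˢ (Finset.univ : Finset (Fin 6)) := by
  intro e he
  rw [B2Eq29Resummation.mem_outer] at he
  refine Finset.mem_product.mpr ⟨Finset.mem_compl.mpr fun hz => ?_, Finset.mem_univ _⟩
  rw [lam_of_lt hk, towerRegionF, towerRegion_eq] at hz
  have hW : largeBlock (largeBlockOf e.1) ⊆ windowF (dataOf s) (radius P Q) k :=
    mem_inLB.mp (regionRel_subset_inLB hρ.le 0 hz)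
  have hself : e.1 ∈ N6 (windowF (dataOf s) (radius P Q) k) (radius P Q k) e := by
    refine mem_nbr.mpr ⟨hW, lt_of_le_of_lt (lbDist_le_tdist e.1 e.1) ?_⟩
    rw [tdist_self]
    exact_mod_cast hρ
  have hin : e.1 ∈ WA Q s k := he hself
  rw [WA, mem_inA, towerRegionF, towerRegion_eq] at hin
  exact hin.2 hz

/-- Hence `#outer ≤ 6·|Λ₀^{(k)c}|` (the print counts `2^{6|Λ₀^{(k)c}|}` subsets). [cite: Balaban1982Higgs2, (3.46) p.593] -/
theorem card_outer_le {Q : B2.Params} {s : LFData P} (hk : k < P.K) (hρ : 0 < radius P Q k) :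
    (B2Eq29Resummation.outer (N6 (windowF (dataOf s) (radius P Q) k) (radius P Q k)) (WA Q s k)).card
      ≤ ((lam Q s k 0)ᶜ).card * 6 := by
  refine (Finset.card_le_card (outer_subset hk hρ)).trans ?_
  rw [Finset.card_product, Finset.card_univ, Fintype.card_fin]

/-- **The cubes `𝒞_k` (merged reading)**: the merged cubes (side `q_k LM > r(Lᵏε)`, `q_k = ⌊r/(LM)⌋ + 1`, gen 9's `qOf`)
containing a large block of `Λ₇^{(k−1)′} ∩ Λ₀^{(k)c}` — `W.image cube` of r14's (3.44)/(3.45).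
[cite: Balaban1982Higgs2, (3.45) p.592] -/
def coverM (bad : (j : ℕ) → Finset (HiggsLattice.Site P j)) (r : ℕ → ℝ) (l : ℕ) : Finset (Fin P.d → ℕ) :=
  (inA bad r l).image (mcube (qOf P r l))

/-- **The premise of (3.44)/(3.45) holds for the merged cubes**: every large block of the neighbourhood of an element lies in
one of the `3^d` cubes around it (*"It is so because a distance of each large block … from the set P_v ∪ … ∪ R_s is
≤ r(Lᵏε)"* and the side is `> r(Lᵏε)`) — r14's hypothesis `hnear`. [cite: Balaban1982Higgs2, (3.44) p.592, (3.45) p.592] -/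
theorem mcube_mem_near_of_mem_nbr {WF : Finset (HiggsLattice.Site P k)} {r : ℕ → ℝ} {z x : HiggsLattice.Site P k}
    (hx : x ∈ nbr WF (r k) z) : mcube (qOf P r k) x ∈ near (qOf P r k) z := by
  obtain ⟨_, hlt⟩ := mem_nbr.mp hx
  -- a site x' of the large block of x with |x' − z| < r < q LM
  obtain ⟨x', hx', hd⟩ := (Finset.inf'_lt_iff _).mp hlt
  have hq := qOf_pos (P := P) r k
  have hside := lt_side (P := P) r k
  have hnat : HiggsLattice.Site.tdist x' z ≤ cubeW P (qOf P r k) - 1 := by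
    have h1 : (HiggsLattice.Site.tdist x' z : ℝ) < (cubeW P (qOf P r k) : ℝ) := by
      refine lt_trans hd (lt_of_lt_of_le hside (le_of_eq ?_))
      unfold cubeW
      push_cast
      ring
    have h2 : HiggsLattice.Site.tdist x' z < cubeW P (qOf P r k) := by exact_mod_cast h1
    omega
  rw [mcube_congr (qOf P r k) ((mem_largeBlock.mp hx').symm)]
  · exact mcube_mem_near hq hnat

/-- **(3.46) FOR THE CONSTRUCTED TOWER, ζ″ := (3.41) DEFINED** (r14's `zeta341` over the level-`k` dictionary): for `k < K`
(`hk`), a positive level-`k` radius `0 < r(Lᵏε)` (`hρ : 0 < radius P Q k` — supplied by `B2Eq342TowerRun.radius_pos` from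
`R ≥ 1`, `r ≥ 0`, `L > 1`, `Lᵏε ≤ 1`, which are therefore NOT hypotheses of this theorem), `a, γ₀ ≥ 0` (`ha`, `hγ`) and EVERY
real `pk` (the slot of the printed `p(Lᵏε)`; no sign or size condition is used),
`ζ″_{Λ₀^{(k)}} ≤ e^{(6 log 2)|Λ₀^{(k)c}|} · e^{−c₀p(Lᵏε)²|𝒞_k|}` with the printed `c₀ = min{⅛a3^{−d}, ¼γ₀3^{−d}, 3^{−d}}`
(`B2.c0 a γ₀ d`) and `|𝒞_k| = |coverM|` — r14's `zeta341_le` with its hypotheses `hnear`/`hcard` DISCHARGED by §2 and the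
count of outer elements by `card_outer_le`. (v1.3: hypothesis list aligned with the signature — referee ref-1 g33 F4-minor
erratum; statement and proof unchanged.) [cite: Balaban1982Higgs2, (3.46) p.593] -/
theorem zeta341_tower_le (Q : B2.Params) (s : LFData P) (hk : k < P.K) (hρ : 0 < radius P Q k)
    (ha : 0 ≤ Q.a) (hγ : 0 ≤ Q.γ₀) (pk : ℝ) :
    B2Eq341Zeta.zeta341 (N6 (windowF (dataOf s) (radius P Q) k) (radius P Q k)) (WA Q s k) Prod.snd Q.a Q.γ₀ pk
      ≤ Real.exp (6 * Real.log 2 * ((((lam Q s k 0)ᶜ).card : ℕ) : ℝ)) *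
        Real.exp (-(B2.c0 Q.a Q.γ₀ P.d * pk ^ 2 * (((coverM (dataOf s) (radius P Q) k).card : ℕ) : ℝ))) := by
  have h := B2Eq341Zeta.zeta341_le (N := N6 (windowF (dataOf s) (radius P Q) k) (radius P Q k)) (W := WA Q s k)
    (mcube (qOf P (radius P Q) k)) (fun e => near (qOf P (radius P Q) k) e.1) (d := P.d)
    (fun e x hx => mcube_mem_near_of_mem_nbr hx) (fun e => card_near_le _ _) Prod.snd ha hγ pk
  -- 2^{#outer} ≤ exp(6 log 2 · |Λ₀ᶜ|)
  have hn := card_outer_le (Q := Q) (s := s) hk hρ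
  have key : (2 : ℝ) ^ (B2Eq29Resummation.outer (N6 (windowF (dataOf s) (radius P Q) k) (radius P Q k)) (WA Q s k)).card
      ≤ Real.exp (6 * Real.log 2 * ((((lam Q s k 0)ᶜ).card : ℕ) : ℝ)) := by
    have e : Real.exp (6 * Real.log 2 * ((((lam Q s k 0)ᶜ).card : ℕ) : ℝ))
        = (2 : ℝ) ^ (((((lam Q s k 0)ᶜ).card * 6 : ℕ)) : ℝ) := by
      rw [Real.rpow_def_of_pos (by norm_num : (0 : ℝ) < 2)]
      congr 1
      push_cast
      ring
    rw [e, Real.rpow_natCast]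
    exact pow_le_pow_right₀ (by norm_num) hn
  refine h.trans ((mul_le_mul_of_nonneg_right key (Real.exp_pos _).le).trans (le_of_eq ?_))
  unfold coverM WA
  congr
  exact Subsingleton.elim _ _

/-- `ζ″ ≥ 0` (a sum of products of exponentials; r14's `zeta341_nonneg`). [cite: Balaban1982Higgs2, (3.41) p.592] -/
theorem zeta341_tower_nonneg (Q : B2.Params) (s : LFData P) (k : ℕ) (pk : ℝ) :
    0 ≤ B2Eq341Zeta.zeta341 (N6 (windowF (dataOf s) (radius P Q) k) (radius P Q k)) (WA Q s k) Prod.snd Q.a Q.γ₀ pk :=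
  B2Eq341Zeta.zeta341_nonneg _ _ _ _ _ _

end Dictionary

/-! ## §4 (3.50)/(3.52) charged to the MERGED cubes: gen 9's covering with one representative site per cube of
`coverM_l` and the radii `2(r_l + LM)` (a merged cube has diameter `< 2(r_l + LM)`) -/

section Covering

variable {k : ℕ}

open Classical in
/-- A representative site of `S` in the merged cube with label `c` (junk if the cube misses `S`). [cite: Balaban1982Higgs2, (3.44) p.592] -/
def mcubeRep (q : ℕ) (S : Finset (HiggsLattice.Site P k)) (c : Fin P.d → ℕ) : HiggsLattice.Site P k :=
  if h : ∃ z ∈ S, mcube q z = c then h.choose else default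

/-- The representative of a cube meeting `S` lies in `S` and in that cube. [cite: Balaban1982Higgs2, (3.44) p.592] -/
theorem mcubeRep_spec {q : ℕ} {S : Finset (HiggsLattice.Site P k)} {c : Fin P.d → ℕ} (h : ∃ z ∈ S, mcube q z = c) :
    mcubeRep q S c ∈ S ∧ mcube q (mcubeRep q S c) = c := by
  unfold mcubeRep
  rw [dif_pos h]
  exact h.choose_spec

/-- One representative site of `S` per merged cube meeting `S`. [cite: Balaban1982Higgs2, (3.44) p.592] -/
def mcubeReps (q : ℕ) (S : Finset (HiggsLattice.Site P k)) : Finset (HiggsLattice.Site P k) :=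
  (S.image (mcube q)).image (mcubeRep q S)

/-- At most as many representatives as cubes meeting `S`. [cite: Balaban1982Higgs2, (3.44) p.592] -/
theorem card_mcubeReps_le (q : ℕ) (S : Finset (HiggsLattice.Site P k)) :
    (mcubeReps q S).card ≤ (S.image (mcube q)).card :=
  Finset.card_image_le

/-- Every site of `S` is within `2qLM − 1` of the representative of its merged cube. [cite: Balaban1982Higgs2, (3.44) p.592] -/
theorem exists_mcubeRep_near {q : ℕ} (hq : 0 < q) (S : Finset (HiggsLattice.Site P k)) {z : HiggsLattice.Site P k}
    (hz : z ∈ S) : ∃ z' ∈ mcubeReps q S, (HiggsLattice.Site.tdist z z' : ℝ) ≤ 2 * ((P.L : ℝ) * P.M * q) - 1 := by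
  refine ⟨mcubeRep q S (mcube q z), Finset.mem_image.mpr ⟨mcube q z, Finset.mem_image_of_mem _ hz, rfl⟩, ?_⟩
  exact tdist_le_of_mcube_eq_real hq (mcubeRep_spec ⟨z, hz, rfl⟩).2.symm

variable {bad : (j : ℕ) → Finset (HiggsLattice.Site P j)} {r : ℕ → ℝ}

/-- One representative site per merged cube of `𝒞_l` (of `coverM_l`). [cite: Balaban1982Higgs2, (3.45) p.592] -/
def srcM (bad : (j : ℕ) → Finset (HiggsLattice.Site P j)) (r : ℕ → ℝ) : (j : ℕ) → Finset (HiggsLattice.Site P j) :=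
  fun l => mcubeReps (qOf P r l) (inA bad r l)

/-- `|srcM_l| ≤ |𝒞_l|`. [cite: Balaban1982Higgs2, (3.45) p.592] -/
theorem card_srcM_le (l : ℕ) : (srcM bad r l).card ≤ (coverM bad r l).card := card_mcubeReps_le _ _

/-- The radii `2(r_l + LM)` used with the representatives (`>` the diameter `2q_lLM − 1` of a merged cube, since
`q_lLM ≤ r_l + LM`); twice gen 9's `rIn`. [cite: Balaban1982Higgs2, (3.50) p.593] -/
def rM (P : HiggsLattice.Params) (r : ℕ → ℝ) (l : ℕ) : ℝ := 2 * rIn P r l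

/-- `r_l ≤ rM_l` for `r_l ≥ 0`. [cite: Balaban1982Higgs2, (3.50) p.593] -/
theorem le_rM {l : ℕ} (hr : 0 ≤ r l) : r l ≤ rM P r l := by
  have h := le_rIn (P := P) r l
  have h1 := one_le_rIn (P := P) hr
  unfold rM
  linarith

/-- `rM_l ≥ 1` for `r_l ≥ 0`. [cite: Balaban1982Higgs2, (3.50) p.593] -/
theorem one_le_rM {l : ℕ} (hr : 0 ≤ r l) : 1 ≤ rM P r l := by
  have h1 := one_le_rIn (P := P) hr
  unfold rM
  linarith

/-- `rM_l ≥ 0` for `r_l ≥ 0`. [cite: Balaban1982Higgs2, (3.50) p.593] -/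
theorem rM_nonneg {l : ℕ} (hr : 0 ≤ r l) : 0 ≤ rM P r l := zero_le_one.trans (one_le_rM hr)

/-- The (3.51) rescaling property passes to `rM`. [cite: Balaban1982Higgs2, (3.51) p.594] -/
theorem rM_rescale {k : ℕ} (hL : 1 < (P.L : ℝ)) {s : ℝ} (hs : 0 ≤ s)
    (hresc : ∀ j, j ≤ k → r (k - j) ≤ (1 + (j : ℝ) * Real.log (P.L : ℝ)) ^ s * r k) :
    ∀ j, j ≤ k → rM P r (k - j) ≤ (1 + (j : ℝ) * Real.log (P.L : ℝ)) ^ s * rM P r k := by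
  intro j hj
  have h := rIn_rescale (P := P) hL hs hresc j hj
  unfold rM
  nlinarith

/-- **The seed inclusion for merged cubes**: a point of the p. 570 seed of `(bad_l, r_l)` is a seed point of
`(srcM_l, 2(r_l + LM))` in the same window. [cite: Balaban1982Higgs2, (2.55) p.570] -/
theorem relSeed_subset_relSeed_srcM {l : ℕ} (hr : 0 ≤ r l) :
    relSeed (windowF bad r l) (↑(bad l) : Set (HiggsLattice.Site P l)) (r l) ⊆
      relSeed (windowF bad r l) (↑(srcM bad r l) : Set (HiggsLattice.Site P l)) (rM P r l) := by
  intro x hx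
  by_cases hW : largeBlock (largeBlockOf x) ⊆ windowF bad r l
  · have hx0 : x ∉ towerRegionF bad r l 0 := by
      rw [towerRegionF, towerRegion_eq]
      exact not_mem_regionRel.mpr hx
    have hxA : x ∈ inA bad r l := mem_inA.mpr ⟨hW, hx0⟩
    obtain ⟨z', hz', hd⟩ := exists_mcubeRep_near (qOf_pos r l) (inA bad r l) hxA
    refine mem_relSeed.mpr (Or.inr (B2Eq28RegionsConcrete.mem_regionCompl_zero.mpr ⟨z', Finset.mem_coe.mpr hz', ?_⟩))
    have hside := side_le (P := P) hr
    calc lbDist x z' ≤ (HiggsLattice.Site.tdist x z' : ℝ) := lbDist_le_tdist x z'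
      _ ≤ 2 * ((P.L : ℝ) * P.M * (qOf P r l : ℝ)) - 1 := hd
      _ < rM P r l := by unfold rM rIn; linarith
  · exact mem_relSeed.mpr (Or.inl hW)

/-- **The regions of the representatives' tower are smaller**: `Λ_i^{(k)}(srcM, 2(r + LM)) ⊆ Λ_i^{(k)}(bad, r)`.
[cite: Balaban1982Higgs2, (3.50) p.593] -/
theorem towerRegionF_srcM_subset {k : ℕ} (hr : ∀ j, j ≤ k → 0 ≤ r j) (i : ℕ) :
    towerRegionF (srcM bad r) (rM P r) k i ⊆ towerRegionF bad r k i :=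
  towerRegion_anti_seed k (fun j hj => relSeed_subset_relSeed_srcM (hr j hj)) (fun j hj => le_rM (hr j hj)) i

/-- **(3.52) for the constructed regions charged to the MERGED cubes, O(1) explicit**:
`|Λ_i^{(k)c}| ≤ (coef352_i · 2(r_k + LM))^d · Σ_{l≤k} |coverM_l|` for radii `r_n ≥ 0` with the (3.51) rescaling property.
[cite: Balaban1982Higgs2, (3.52) p.594] -/
theorem card_compl_towerRegion_le_352_coverM {k : ℕ} (hk : k ≤ P.K) (hL : 1 < (P.L : ℝ)) {s : ℝ} (hs : 0 ≤ s)
    (hr : ∀ n, n ≤ k → 0 ≤ r n)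
    (hresc : ∀ j, j ≤ k → r (k - j) ≤ (1 + (j : ℝ) * Real.log (P.L : ℝ)) ^ s * r k) (i : ℕ) :
    (((towerRegionF bad r k i)ᶜ).card : ℝ) ≤
      (coef352 P (S351 (P.L : ℝ) s) i * (2 * (r k + (P.L : ℝ) * P.M))) ^ P.d
        * ∑ l ∈ Finset.range (k + 1), ((coverM bad r l).card : ℝ) := by
  have h1 : (((towerRegionF bad r k i)ᶜ).card : ℝ) ≤ (((towerRegionF (srcM bad r) (rM P r) k i)ᶜ).card : ℝ) := by
    exact_mod_cast Finset.card_le_card (Finset.compl_subset_compl.mpr (towerRegionF_srcM_subset hr i))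
  refine h1.trans ((card_compl_towerRegion_le_352 hk hL hs (fun n hn => rM_nonneg (hr n hn))
    (one_le_rM (hr k le_rfl)) (rM_rescale hL hs hresc) i).trans ?_)
  unfold rM rIn
  refine mul_le_mul_of_nonneg_left (Finset.sum_le_sum fun l _ => ?_) (pow_nonneg ?_ _)
  · exact_mod_cast card_srcM_le l
  · refine mul_nonneg (coef352_nonneg (zero_le_one.trans (one_le_S351 (r := s) hL)) i) ?_
    have := hr k le_rfl
    have := (LM_pos P).le
    linarith

/-- **(3.52), merged cubes, printed radii `r(Lᵐε)`** (`R ≥ 1`, `s ≥ 0`, `L > 1`, `Lᵏε ≤ 1`, `k ≤ K`):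
`|Λ_i^{(k)c}| ≤ (coef352_i · 2(1 + LM))^d · r(Lᵏε)^d · Σ_{l≤k} |coverM_l|`. [cite: Balaban1982Higgs2, (3.52) p.594] -/
theorem card_compl_towerRegion_le_352_coverM_rFn {ε R s : ℝ} (hε : 0 < ε) (hR : 1 ≤ R) (hs : 0 ≤ s)
    (hL : 1 < (P.L : ℝ)) {k : ℕ} (hk : k ≤ P.K) (hkε : (P.L : ℝ) ^ k * ε ≤ 1) (i : ℕ) :
    (((towerRegionF bad (fun m => B2.rFn R s ((P.L : ℝ) ^ m * ε)) k i)ᶜ).card : ℝ) ≤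
      (coef352 P (S351 (P.L : ℝ) s) i * (2 * (1 + (P.L : ℝ) * P.M))) ^ P.d * B2.rFn R s ((P.L : ℝ) ^ k * ε) ^ P.d
        * ∑ l ∈ Finset.range (k + 1), ((coverM bad (fun m => B2.rFn R s ((P.L : ℝ) ^ m * ε)) l).card : ℝ) := by
  have hL0 : (0 : ℝ) < P.L := by linarith
  have hmono : ∀ n, n ≤ k → (P.L : ℝ) ^ n * ε ≤ 1 := fun n hn =>
    le_trans (mul_le_mul_of_nonneg_right (pow_le_pow_right₀ hL.le hn) hε.le) hkε
  have hrk : 1 ≤ B2.rFn R s ((P.L : ℝ) ^ k * ε) := one_le_rFn hL0 hε hR hs hkε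
  refine (card_compl_towerRegion_le_352_coverM hk hL hs
    (fun n hn => rFn_nonneg hL0 hε (by linarith) n (hmono n hn))
    (fun j hj => rFn_rescale_le hL.le hε (by linarith) hs hj hkε) i).trans ?_
  have hsum : 0 ≤ ∑ l ∈ Finset.range (k + 1),
      ((coverM bad (fun m => B2.rFn R s ((P.L : ℝ) ^ m * ε)) l).card : ℝ) :=
    Finset.sum_nonneg fun _ _ => Nat.cast_nonneg _
  rw [← mul_pow]
  refine mul_le_mul_of_nonneg_right (pow_le_pow_left₀ ?_ ?_ P.d) hsum
  · refine mul_nonneg (coef352_nonneg (zero_le_one.trans (one_le_S351 (r := s) hL)) i) ?_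
    have := (LM_pos P).le
    linarith
  · have hc := coef352_nonneg (P := P) (zero_le_one.trans (one_le_S351 (r := s) hL)) i
    have hLM := (LM_pos P).le
    rw [mul_assoc]
    refine mul_le_mul_of_nonneg_left ?_ hc
    nlinarith

end Covering

/-! ## §5 The run with ζ″ := (3.41): `Bound352`, the collars, (3.46) AS A THEOREM, and (3.42) / the claim of Sect. 3.C for
the constructed towers with NO field-side hypothesis left -/

section Chain

variable {Q : B2.Params} {s : LFData P} {F : FieldData P}

/-- **The combinatorial data with the merged cubes**: `|𝒞_l| := |coverM_l|`, `|Λ₀^{(k)c}|`, `|T₁^{(K)}|`.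
[cite: Balaban1982Higgs2, (3.45) p.592, p.593] -/
def towerCDataM (P : HiggsLattice.Params) (Q : B2.Params) (F : FieldData P) : CData (towerRun P Q F) where
  nC := fun l (s : LFData P) => (coverM (dataOf s) (radius P Q) l).card
  vol0c := fun k (s : LFData P) => ((lam Q s k 0)ᶜ).card
  volTK := Fintype.card (HiggsLattice.Site P P.K)

/-- **The O(1) of (3.52) for `Λ_i`, merged cubes**: `D′_i = ((4·max(i+1,8)·S351·LM + 1)·2(1 + LM))^d`.
[cite: Balaban1982Higgs2, (3.52) p.594] -/
def DM352 (P : HiggsLattice.Params) (r : ℝ) (i : ℕ) : ℝ :=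
  (coef352 P (S351 (P.L : ℝ) r) i * (2 * (1 + (P.L : ℝ) * P.M))) ^ P.d

/-- `D′_i ≥ 0`. [cite: Balaban1982Higgs2, (3.52) p.594] -/
theorem DM352_nonneg (hL : 1 < (P.L : ℝ)) (r : ℝ) (i : ℕ) : 0 ≤ DM352 P r i := by
  unfold DM352
  have hS : 0 ≤ S351 (P.L : ℝ) r := zero_le_one.trans (one_le_S351 hL)
  have h1 := coef352_nonneg (P := P) hS i
  have h2 := (LM_pos P).le
  positivity

/-- (3.52), merged cubes, for every region of the run below `K`. [cite: Balaban1982Higgs2, (3.52) p.594] -/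
theorem card_compl_lam_le_M (hR : 1 ≤ Q.R) (hr : 0 ≤ Q.r) (hL : 1 < (P.L : ℝ)) {k : ℕ} (hk : k < P.K)
    (hkε : (P.L : ℝ) ^ k * P.ε ≤ 1) (i : ℕ) :
    ((((lam Q s k i)ᶜ).card : ℕ) : ℝ) ≤ DM352 P Q.r i * radius P Q k ^ P.d
      * ∑ l ∈ Finset.range (k + 1), ((coverM (dataOf s) (radius P Q) l).card : ℝ) := by
  rw [lam_of_lt hk]
  have h := card_compl_towerRegion_le_352_coverM_rFn (bad := dataOf s) P.hε hR hr hL hk.le hkε i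
  unfold DM352 radius
  exact h

/-- **r14's leaf `Bound352` for the run, merged cubes.** [cite: Balaban1982Higgs2, (3.52) p.594] -/
theorem bound352M (hd : Q.d = P.d) (hLQ : Q.L = P.L) (hR : 1 ≤ Q.R) (hr : 0 ≤ Q.r) (hL : 1 < (P.L : ℝ))
    (hK1 : (P.L : ℝ) ^ P.K * P.ε ≤ 1) :
    Bound352 Q (towerRun P Q F) (towerCDataM P Q F) (DM352 P Q.r 0) := by
  intro s k hk
  have hk' : k < P.K := hk
  have h := card_compl_lam_le_M (s := s) hR hr hL hk' (mesh_le_one_of_le hL.le hk'.le hK1) 0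
  rw [B2Eq342TowerRun.rFn_epsK_pow_eq hd hLQ]
  exact h

/-- **The `Λ₇`-collar bound, merged cubes.** [cite: Balaban1982Higgs2, (3.52) p.594, (3.42) p.592] -/
theorem collar7M (hd : Q.d = P.d) (hLQ : Q.L = P.L) (hR : 1 ≤ Q.R) (hr : 0 ≤ Q.r) (hL : 1 < (P.L : ℝ))
    (hK1 : (P.L : ℝ) ^ P.K * P.ε ≤ 1) :
    ∀ (s : LFData P) (k : ℕ), k < (towerRun P Q F).K → ((towerRun P Q F).vol7 k s : ℝ)
      ≤ DM352 P Q.r 7 * B2.rFn Q.R Q.r (B2Sect3C.epsK Q (towerRun P Q F) k) ^ Q.d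
        * ∑ j ∈ Finset.range (k + 1), ((towerCDataM P Q F).nC j s : ℝ) := by
  intro s k hk
  have hk' : k < P.K := hk
  have h := card_compl_lam_le_M (s := s) hR hr hL hk' (mesh_le_one_of_le hL.le hk'.le hK1) 7
  rw [B2Eq342TowerRun.rFn_epsK_pow_eq hd hLQ, B2Eq342TowerRun.towerRun_vol7]
  refine le_trans ?_ h
  exact_mod_cast B2Eq342TowerRun.card_sdiff_le_card_compl _ _

/-- **The `Λ₅`-collar bound, merged cubes.** [cite: Balaban1982Higgs2, (3.52) p.594, (3.42) p.592] -/
theorem collar5M (hd : Q.d = P.d) (hLQ : Q.L = P.L) (hR : 1 ≤ Q.R) (hr : 0 ≤ Q.r) (hL : 1 < (P.L : ℝ))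
    (hK1 : (P.L : ℝ) ^ P.K * P.ε ≤ 1) :
    ∀ (s : LFData P) (k : ℕ), k < (towerRun P Q F).K → ((towerRun P Q F).vol5 k s : ℝ)
      ≤ DM352 P Q.r 5 * B2.rFn Q.R Q.r (B2Sect3C.epsK Q (towerRun P Q F) k) ^ Q.d
        * ∑ j ∈ Finset.range (k + 1), ((towerCDataM P Q F).nC j s : ℝ) := by
  intro s k hk
  have hk' : k < P.K := hk
  have h := card_compl_lam_le_M (s := s) hR hr hL hk' (mesh_le_one_of_le hL.le hk'.le hK1) 5
  rw [B2Eq342TowerRun.rFn_epsK_pow_eq hd hLQ, B2Eq342TowerRun.towerRun_vol5]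
  refine le_trans ?_ h
  exact_mod_cast B2Eq342TowerRun.card_sdiff_le_card_compl _ _

/-- **ζ″_{Λ₀^{(k)}} OF THE RUN := (3.41)** (r14's `zeta341`) over the level-`k` dictionary of §3, at `p(Lᵏε) = b₀(1 + log(Lᵏε)⁻¹)ᵖ`.
[cite: Balaban1982Higgs2, (3.41) p.592] -/
def zetaT (Q : B2.Params) (s : LFData P) (k : ℕ) : ℝ :=
  B2Eq341Zeta.zeta341 (N6 (windowF (dataOf s) (radius P Q) k) (radius P Q k)) (WA Q s k) Prod.snd Q.a Q.γ₀
    (B2.pFn Q.b₀ Q.p ((P.L : ℝ) ^ k * P.ε))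

/-- **The field data with ζ″ := (3.41) DEFINED** and the two given O(1)'s `C₇, C₅` of (3.42).
[cite: Balaban1982Higgs2, (3.41)–(3.42) p.592] -/
def concreteF (P : HiggsLattice.Params) (Q : B2.Params) (C₇ C₅ : ℝ) : FieldData P where
  zeta := fun k s => zetaT Q s k
  C₇ := C₇
  C₅ := C₅

/-- **(3.42) FOR THE CONSTRUCTED TOWER WITH ζ″ := (3.41) — NO FIELD-SIDE HYPOTHESIS LEFT**:
`B2.Ineq342With Q (towerRun P Q (concreteF P Q C₇ C₅)) (C₇ + C₅ + 1)` from the printed constants' ranges (`R ≥ 1`, `r ≥ 2`,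
`a, γ₀, κ₀, C₇, C₅ ≥ 0`, `L > 1`), the stopping rule in the form `Lᴷε ≤ 1`, and the per-scale (3.54) condition with
`O(1) = (6 log 2 + (d+1) + C₇ + C₅)(D′₀ + D′₇ + D′₅)/(R log L)` — p23's `ineq342_of_346_blocks` with EVERY hypothesis
discharged: (3.46) by `zeta341_tower_le`, (3.52) and the collars by §4, the count inputs by `B2Eq342TowerRun` §4.
[cite: Balaban1982Higgs2, (3.42) p.592, Sect. 3.C pp.592–594] -/
theorem ineq342_concrete {C₇ C₅ : ℝ} (hd : Q.d = P.d) (hLQ : Q.L = P.L) (hL1 : 1 < Q.L) (hR : 1 ≤ Q.R)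
    (hr : 2 ≤ Q.r) (hκ : 0 ≤ Q.κ₀) (ha : 0 ≤ Q.a) (hγ : 0 ≤ Q.γ₀) (hC₇ : 0 ≤ C₇) (hC₅ : 0 ≤ C₅)
    (hK1 : (P.L : ℝ) ^ P.K * P.ε ≤ 1)
    (hcond : ∀ k, k < P.K →
        (6 * Real.log 2 + ((Q.d : ℝ) + 1) + C₇ + C₅) * (DM352 P Q.r 0 + DM352 P Q.r 7 + DM352 P Q.r 5)
            / (Q.R * Real.log (Q.L : ℝ)) * Q.R ^ (Q.d + 1)
          ≤ B2.c0 Q.a Q.γ₀ Q.d * Q.b₀ ^ 2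
            * B2Sect3C.xk Q (towerRun P Q (concreteF P Q C₇ C₅)) k ^ (2 * Q.p - ((Q.d : ℝ) + 1) * Q.r)) :
    B2.Ineq342With Q (towerRun P Q (concreteF P Q C₇ C₅)) (C₇ + C₅ + 1) := by
  set F := concreteF P Q C₇ C₅ with hF
  have hLP : 1 < (P.L : ℝ) := by rw [← hLQ]; exact_mod_cast hL1
  have hL2 : 2 ≤ (Q.L : ℝ) := by exact_mod_cast hL1
  have hR0 : 0 < Q.R := lt_of_lt_of_le zero_lt_one hR
  have hr0 : 0 ≤ Q.r := by linarith
  have hlog2 : 0 ≤ 6 * Real.log 2 := by positivity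
  have hK1' : B2Sect3C.epsK Q (towerRun P Q F) (towerRun P Q F).K ≤ 1 := by
    rw [B2Eq342TowerRun.towerRun_K, B2Eq342TowerRun.epsK_towerRun hLQ]; exact hK1
  have hrad : ∀ k : Fin P.K, 0 < radius P Q k := fun k =>
    radius_pos hR hr0 hLP (mesh_le_one_of_le hLP.le k.isLt.le hK1)
  have h := B2Ineq342From346.ineq342_of_346_blocks Q (towerRun P Q F) (towerCDataM P Q F)
    (a₆ := 6 * Real.log 2) (θ := (Q.d : ℝ) + 1) (D := DM352 P Q.r 0) (D₇ := DM352 P Q.r 7) (D₅ := DM352 P Q.r 5)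
    (m := 1) (fun k : Fin P.K => HiggsLattice.Site P k) (fun (s : LFData P) (k : Fin P.K) => s k) (fun _ _ h => h)
    hL2 hR0 hr P.hε hK1' hκ hC₇ hC₅ hlog2 (by positivity) (DM352_nonneg hLP _ 0) (DM352_nonneg hLP _ 7)
    (DM352_nonneg hLP _ 5) zero_lt_one (by rw [mul_one]) B2Eq342TowerRun.volTK_le_volT
    (fun s k _ => zeta341_tower_nonneg Q s k _)
    (fun s k hk => by
      rw [B2Eq342TowerRun.epsK_towerRun hLQ, hd]
      exact zeta341_tower_le Q s hk (hrad ⟨k, hk⟩) ha hγ _)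
    (bound352M hd hLQ hR hr0 hLP hK1) (collar7M hd hLQ hR hr0 hLP hK1) (collar5M hd hLQ hR hr0 hLP hK1)
    B2Eq342TowerRun.vol7_K_le B2Eq342TowerRun.vol5_K_le (B2Eq342TowerRun.card_data_le_vol0c (F := F) hrad)
    (fun k => by
      rw [B2Eq342TowerRun.epsK_towerRun hLQ, B2Eq342TowerRun.epsK_towerRun hLQ, hd]
      exact B2Eq342TowerRun.card_site_mul_mesh_pow k.isLt.le)
    hcond
  have e7 : (towerRun P Q F).C₇ = C₇ := rfl
  have e5 : (towerRun P Q F).C₅ = C₅ := rfl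
  rw [e7, e5, div_one] at h
  exact h

/-- **The O(1)'s of (3.52), merged cubes, as functions of `d, L, M, r` alone.** [cite: Balaban1982Higgs2, (3.52) p.594] -/
def DuM (Q : B2.Params) (M : ℕ) (i : ℕ) : ℝ :=
  ((4 * max ((i : ℝ) + 1) 8 * S351 (Q.L : ℝ) Q.r * ((Q.L : ℝ) * M) + 1) * (2 * (1 + (Q.L : ℝ) * M))) ^ Q.d

/-- **An instance of the construction with ζ″ := (3.41)**: only the lattice is data (any `ε`, `K`, `L′_μ`; `d, L, M` fixed).
[cite: Balaban1982Higgs2, (2.117) p.582, (3.42) p.592] -/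
structure InstanceC (Q : B2.Params) (M : ℕ) : Type where
  /-- the lattice of the instance -/
  P : HiggsLattice.Params
  /-- its dimension is the `d` of `Q` -/
  hd : Q.d = P.d
  /-- its scaling integer is the `L` of `Q` -/
  hL : Q.L = P.L
  /-- its block integer is `M` -/
  hM : P.M = M

/-- For an instance, `DM352 = DuM`. [cite: Balaban1982Higgs2, (3.52) p.594] -/
theorem DM352_eq_DuM {M : ℕ} (I : InstanceC Q M) (i : ℕ) : DM352 I.P Q.r i = DuM Q M i := by
  unfold DM352 DuM coef352
  rw [← I.hL, ← I.hd, I.hM]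

/-- `DuM ≥ 0` (`L > 1`). [cite: Balaban1982Higgs2, (3.52) p.594] -/
theorem DuM_nonneg (hL : 1 < (Q.L : ℝ)) (M i : ℕ) : 0 ≤ DuM Q M i := by
  unfold DuM
  have hS : 0 ≤ S351 (Q.L : ℝ) Q.r := zero_le_one.trans (one_le_S351 hL)
  have hmax : 0 ≤ max ((i : ℝ) + 1) 8 := le_max_of_le_right (by norm_num)
  have hLM : 0 ≤ (Q.L : ℝ) * M := by positivity
  positivity

/-- **The family of runs of all constructed towers with ζ″ := (3.41)** and given O(1)'s `C₇, C₅` of (3.42).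
[cite: Balaban1982Higgs2, (2.117) p.582, (3.42) p.592] -/
def famC (Q : B2.Params) (M : ℕ) (C₇ C₅ : ℝ) : ℝ → InstanceC Q M → B2.Run :=
  fun _ I => towerRun I.P Q (concreteF I.P Q C₇ C₅)

/-- Unfolding of the family. [cite: Balaban1982Higgs2, (3.42) p.592] -/
@[simp] theorem famC_apply (Q : B2.Params) (M : ℕ) (C₇ C₅ ε₀ : ℝ) (I : InstanceC Q M) :
    famC Q M C₇ C₅ ε₀ I = towerRun I.P Q (concreteF I.P Q C₇ C₅) := rfl

/-- **THE CLAIM OF SECT. 3.C, `B2.Claim342Printed` (decl of record of SKELETON row B2.Eq3.42), PROVED for the family of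
all constructed towers with ζ″ := (3.41) DEFINED** — strict case `2p > (d+1)r` (*"if 2p ≥ (d+1)r and ε₀ is sufficiently
small"*, p. 594; equality case: cell GAPS G-pv04-2), from the printed constants' ranges only (`Q.Printed`: `p > 2`, `r > 1`,
`L > 1`, `d ∈ {2,3}`, `a, γ₀, b₀, R > 0`; plus `R ≥ 1` (print: `R > R₀`), `r ≥ 2` (p. 594), `κ₀ ≥ 0`, `C₇, C₅ ≥ 0`).
Threshold `ε₁ = min{1, e^{1−x₀}}`, constant `C₇ + C₅ + 1`. [cite: Balaban1982Higgs2, (3.42) p.592, Sect. 3.C pp.592–594, (2.117) p.582] -/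
theorem claim342_concrete {M : ℕ} {C₇ C₅ : ℝ} (hP : Q.Printed) (hR : 1 ≤ Q.R) (hr : 2 ≤ Q.r) (hκ : 0 ≤ Q.κ₀)
    (hpr : ((Q.d : ℝ) + 1) * Q.r < 2 * Q.p) (hC₇ : 0 ≤ C₇) (hC₅ : 0 ≤ C₅) :
    B2.Claim342Printed Q (famC Q M C₇ C₅) := by
  intro _
  obtain ⟨_, _, hL1, _, ha, hγ, hb, hR0⟩ := hP
  have hL' : 1 < (Q.L : ℝ) := by exact_mod_cast hL1
  have hlogL : 0 < Real.log (Q.L : ℝ) := Real.log_pos hL'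
  have hc : 0 < B2.c0 Q.a Q.γ₀ Q.d := B2Sect3C.c0_pos ha hγ Q.d
  have hlog2 : 0 ≤ 6 * Real.log 2 := by positivity
  have hDsum0 : 0 ≤ DuM Q M 0 + DuM Q M 7 + DuM Q M 5 :=
    add_nonneg (add_nonneg (DuM_nonneg hL' M 0) (DuM_nonneg hL' M 7)) (DuM_nonneg hL' M 5)
  have hA0 : 0 ≤ 6 * Real.log 2 + ((Q.d : ℝ) + 1) + C₇ + C₅ := by positivity
  have hC'0 : 0 ≤ (6 * Real.log 2 + ((Q.d : ℝ) + 1) + C₇ + C₅) * (DuM Q M 0 + DuM Q M 7 + DuM Q M 5)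
      / (Q.R * Real.log (Q.L : ℝ)) := by positivity
  obtain ⟨x₀, _, hx₀⟩ := B2.coeff354_threshold (d := Q.d) hc hb hC'0 hR0.le hpr
  refine ⟨min 1 (Real.exp (1 - x₀)), lt_min zero_lt_one (Real.exp_pos _), fun ε₀ hε₀ hε₀1 =>
    ⟨C₇ + C₅ + 1, ?_⟩⟩
  intro I hε _ hstop
  have hε₀one : ε₀ ≤ 1 := le_trans hε₀1 (min_le_left _ _)
  have hK1 : (I.P.L : ℝ) ^ I.P.K * I.P.ε ≤ 1 := by
    have h : (Q.L : ℝ) ^ I.P.K * I.P.ε ≤ ε₀ := hstop.1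
    rw [I.hL] at h
    exact h.trans hε₀one
  have hcond : ∀ k, k < I.P.K →
      (6 * Real.log 2 + ((Q.d : ℝ) + 1) + C₇ + C₅) * (DM352 I.P Q.r 0 + DM352 I.P Q.r 7 + DM352 I.P Q.r 5)
          / (Q.R * Real.log (Q.L : ℝ)) * Q.R ^ (Q.d + 1)
        ≤ B2.c0 Q.a Q.γ₀ Q.d * Q.b₀ ^ 2
          * B2Sect3C.xk Q (towerRun I.P Q (concreteF I.P Q C₇ C₅)) k ^ (2 * Q.p - ((Q.d : ℝ) + 1) * Q.r) := by
    intro k hk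
    rw [DM352_eq_DuM I 0, DM352_eq_DuM I 7, DM352_eq_DuM I 5]
    have h1 : 1 + Real.log ε₀⁻¹ ≤ B2Sect3C.xk Q (towerRun I.P Q (concreteF I.P Q C₇ C₅)) k :=
      B2.logScale_ge hL'.le hε hk hstop.1
    have h2 : x₀ ≤ 1 + Real.log ε₀⁻¹ := by
      have : Real.log ε₀ ≤ 1 - x₀ := by
        have := Real.log_le_log hε₀ (le_trans hε₀1 (min_le_right _ _))
        rwa [Real.log_exp] at this
      rw [Real.log_inv]
      linarith
    exact hx₀ _ (le_trans h2 h1)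
  have h342 := ineq342_concrete (P := I.P) (C₇ := C₇) (C₅ := C₅) I.hd I.hL hL1 hR hr hκ ha.le hγ.le hC₇ hC₅ hK1 hcond
  rw [famC_apply]
  exact h342

end Chain

/-! ## §6 (v1.1, append-only) (3.45) AS PRINTED on the torus for the step's own data, and non-vacuity of (3.41):
`|𝒞_k| ≤ 3^d·|P^{(k)}|` and `ζ″_{Λ₀^{(k)}} > 0` -/

section Printed345

open scoped Classical

variable {k : ℕ}

/-- **(3.45) AS PRINTED, on the torus, for the constructed tower**: `|𝒞_k| ≤ 3^d(|P_v^{(k)}| + … + |R_s^{(k)}|)` with the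
six sets read as the step's large-field data `P^{(k)}` (one finite set; the tuple `P^{(k)} × {σ}` is admissible,
`admissible_data`) and `𝒞_k` the merged cubes `coverM_k` — r14's `B2Eq341Zeta.card_cover_le` with its cube hypotheses
DISCHARGED by §2. [cite: Balaban1982Higgs2, (3.45) p.592] -/
theorem card_coverM_le_three_pow (Q : B2.Params) (s : LFData P) (k : ℕ) :
    (coverM (dataOf s) (radius P Q) k).card ≤ 3 ^ P.d * (dataOf s k).card := by
  have h := B2Eq341Zeta.card_cover_le (N := N6 (windowF (dataOf s) (radius P Q) k) (radius P Q k)) (W := WA Q s k)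
    (mcube (qOf P (radius P Q) k)) (fun e => near (qOf P (radius P Q) k) e.1) (d := P.d)
    (fun e x hx => mcube_mem_near_of_mem_nbr hx) (fun e => card_near_le _ _) (admissible_data Q s k 0)
  have hcard : ((dataOf s k) ×ˢ ({0} : Finset (Fin 6))).card = (dataOf s k).card := by
    rw [Finset.card_product, Finset.card_singleton, mul_one]
  rw [hcard] at h
  refine le_trans (le_of_eq ?_) h
  unfold coverM WA
  congr
  exact Subsingleton.elim _ _

/-- **(3.41) is a non-trivial sum**: the step's data contains a MINIMAL admissible tuple (r02's `exists_minimal_subset`,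
*"Thus, there are minimal elements in the class"*, p. 558), so `ζ″_{Λ₀^{(k)}} > 0` for the run's DEFINED ζ″ — every summand of
(3.41) is a product of exponentials. [cite: Balaban1982Higgs2, (2.9) p.558, (3.41) p.592] -/
theorem zetaT_pos (Q : B2.Params) (s : LFData P) (k : ℕ) : 0 < zetaT Q s k := by
  unfold zetaT B2Eq341Zeta.zeta341
  obtain ⟨m, _, hmin⟩ := B2Eq29Resummation.exists_minimal_subset (admissible_data Q s k 0)
  have hm : m ∈ B2Eq29Resummation.minimals (N6 (windowF (dataOf s) (radius P Q) k) (radius P Q k)) (WA Q s k) :=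
    B2Eq29Resummation.mem_minimals.mpr hmin
  refine lt_of_lt_of_le ?_ (Finset.single_le_sum (f := fun τ => ∏ x ∈ τ, B2Eq341Zeta.weight341 Prod.snd Q.a Q.γ₀
    (B2.pFn Q.b₀ Q.p ((P.L : ℝ) ^ k * P.ε)) x) (fun τ _ => Finset.prod_nonneg fun x _ => (Real.exp_pos _).le) hm)
  exact Finset.prod_pos fun x _ => Real.exp_pos _

end Printed345

/-! ## §7 (v1.2, append-only) Non-vacuity of the family: for the printed parameter ranges the index type `InstanceC Q M`
is inhabited (tori of every `K`, `ε`, `L′_μ`), so `claim342_concrete` is not a statement about an empty family -/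

section NonVacuity

/-- **A torus of the family**: for `d ≥ 1`, `L ≥ 1`, `M ≥ 1` (implied by `Q.Printed` and the construction's `M`), any number
of steps `K`, any spacing `ε > 0` and any sizes `L′_μ ≥ 1`, the lattice of part I (1.2) with these integers is an instance
(p. 604: *"K, L, M, L′_μ are some positive integers"*). [cite: Balaban1982Higgs2, (1.1) p.555, (2.117) p.582] -/
def mkInstanceC (Q : B2.Params) (M : ℕ) (hd : 1 ≤ Q.d) (hL : 0 < Q.L) (hM : 0 < M) (K : ℕ) {ε : ℝ} (hε : 0 < ε)
    (Lp : Fin Q.d → ℕ) (hLp : ∀ μ, 0 < Lp μ) : InstanceC Q M where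
  P := { d := Q.d, ε := ε, K := K, L := Q.L, M := M, Lp := Lp, hd := hd, hε := hε, hL := hL, hM := hM, hLp := hLp }
  hd := rfl
  hL := rfl
  hM := rfl

/-- The instance has the prescribed number of steps and spacing. [cite: Balaban1982Higgs2, (2.117) p.582] -/
theorem mkInstanceC_K_ε (Q : B2.Params) (M : ℕ) (hd : 1 ≤ Q.d) (hL : 0 < Q.L) (hM : 0 < M) (K : ℕ) {ε : ℝ}
    (hε : 0 < ε) (Lp : Fin Q.d → ℕ) (hLp : ∀ μ, 0 < Lp μ) :
    (mkInstanceC Q M hd hL hM K hε Lp hLp).P.K = K ∧ (mkInstanceC Q M hd hL hM K hε Lp hLp).P.ε = ε := ⟨rfl, rfl⟩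

/-- **The family of `claim342_concrete` is non-empty under the printed parameter ranges** (`Q.Printed` gives `d ∈ {2, 3}`,
`L > 1`; `M ≥ 1`): for every `K` and `ε > 0` there is an instance with `K` steps and spacing `ε` — so the claim quantifies over
actual runs (and, for `ε ≤ ε₀ < Lε·…`, over runs obeying the stopping rule). [cite: Balaban1982Higgs2, (2.117) p.582, (3.42) p.592] -/
theorem instanceC_nonempty {Q : B2.Params} {M : ℕ} (hP : Q.Printed) (hM : 0 < M) (K : ℕ) {ε : ℝ} (hε : 0 < ε) :
    ∃ I : InstanceC Q M, I.P.K = K ∧ I.P.ε = ε := by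
  obtain ⟨_, _, hL, hd, _⟩ := hP
  have hd1 : 1 ≤ Q.d := by rcases hd with h | h <;> omega
  have hL0 : 0 < Q.L := lt_trans zero_lt_one hL
  exact ⟨mkInstanceC Q M hd1 hL0 hM K hε (fun _ => 1) (fun _ => one_pos), rfl, rfl⟩

end NonVacuity

end Literature.MathematicalPhysics.QuantumFieldTheory.Balaban1983to89.B2Eq346TowerZeta

end
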